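import Summits.CriticalPhenomena.Ising3DConformalLimit.Theorems.UniformRegularity.Negative.LoadBearing
import Literature.Probability.LatticeModels.CriticalUrsellFourSign
import HarnessLib

/-!
# Crux `UniformRegularity` (item stmt-CriticalPhenomena-4658) — load-bearing hypotheses of clause (b) and the
# order `n = 2` of clause (c) (standing crux disprover, cycle 1)

THEOREM-ONLY negative lemmas (no positive route-item conclusion), continuing
`Negative/LoadBearing.lean` (which settled clause (a) without `NonCoincident` / without `IsCompact`, and clause (c)
without `IsCompact`). Write `F_δ(n; x) = ρ★(δ)ⁿ ⟨∏ σ_{[xᵢ/δ]}⟩⁺_{β_c}`, `ρ★(δ) = ⟨σ₀σ_{⌊δ⁻¹⌋e₀}⟩^{-1/2}`, exactly as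
in the item, and `g(w) = ⟨σ₀σ_w⟩⁺_{β_c}` (`criticalTwoPoint 3 w`).

* `clauseB_false_without_nonCoincident` : clause (b) (asymptotic uniform equicontinuity on `K`) with
  `K ⊆ NonCoincident 3 n` DROPPED is false — witness the compact segment `K = {(0, t e₀) : t ∈ [0,1]}` through the
  diagonal: `F_δ(2; 0, 0) − F_δ(2; 0, t e₀) = (1 − g(⌊t/δ⌋e₀))/g(⌊δ⁻¹⌋e₀) ≥ 1/2` however small `t > 0`, once
  `δ ≪ t` (`g ≤ 1` at the pin, `g(k e₀) → 0`).
* `clauseB_false_without_compact` : clause (b) with `IsCompact K` DROPPED is false — witness the bounded,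
  non-closed `K = {(0, t e₀) : t ∈ (0,1]} ⊆ NonCoincident 3 2`: the pair `(0, (δ/2)e₀)`, `(0, t e₀)` is `t`-close but
  `F_δ` differs by `(1 − g(⌊t/δ⌋e₀))/g(⌊δ⁻¹⌋e₀) ≥ 1/2`.
* `clauseB_false_with_meshUniform_delta0` : the NATURAL STRENGTHENING of clause (b) in which `δ₀` is chosen
  BEFORE `ε` (genuine equicontinuity of the family `{F_δ : δ < δ₀}` instead of asymptotic equicontinuity) is false
  even on the compact `K = {(0, t e₀) : t ∈ [1,3]} ⊆ NonCoincident 3 2`: at a fixed mesh `x ↦ F_δ(2; x)` is a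
  lattice step function with a genuine jump `(g(k e₀) − g((k+1)e₀))/g(⌊δ⁻¹⌋e₀) > 0` inside `K`
  (a strict decrease `g(k e₀) > g((k+1) e₀)` exists beyond every `k₀` because `g > 0` and `g(k e₀) → 0`). So the
  dependence `δ₀ = δ₀(ε, K)` in the item is load-bearing, not cosmetic.
* `clauseC_false_at_odd` : clause (c) (a positive lower bound) transplanted from `n = 2` to any ODD order `n` is
  false: `F_δ(n; ·) ≡ 0` for odd `n` (`m*(β_c) = 0`, tree `criticalCorr_eq_zero_of_odd`), witnessed on the compact
  singleton `{(0, e₀, 2e₀, …)} ⊆ NonCoincident 3 n`. (At even `n ≥ 4` the lower bound follows from the `n = 2`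
  clause by Griffiths' second inequality — a positive statement, not recorded here.)

References: B. Simon, Comm. Math. Phys. 77 (1980) 111 (Simon–Lieb); J. Fröhlich, B. Simon, T. Spencer,
Comm. Math. Phys. 50 (1976) 79 (infrared bound) — together the tree theorem `criticalTwoPoint_bounds_holds`;
M. Aizenman, H. Duminil-Copin, V. Sidoravicius, Comm. Math. Phys. 334 (2015) 719 (`m*(β_c) = 0`).
-/

open Summit.CriticalPhenomena.Ising3DConformalLimit.Theses
open Literature.Probability.LatticeModels
open Filter Set
open scoped Topology
open Summit.CriticalPhenomena.Ising3DConformalLimit.PinnedClusterPoints (criticalTwoPoint_pos3)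

namespace Summit.CriticalPhenomena.Ising3DConformalLimit.UniformRegularityNegative

/-! ### Small lemmas on axis pairs -/

/-- The axis-pair parametrisation `t ↦ (0, t e₀)` is continuous. [folklore] -/
theorem continuous_axisPair :
    Continuous fun t : ℝ =>
      ((![0, EuclideanSpace.single (0 : Fin 3) t] : Fin 2 → EuclideanSpace ℝ (Fin 3))) := by
  -- `t • e₀ = single 0 t` (landed elsewhere as `proxy_smul_unitVec`; inlined to keep the import cone small)
  have hs : ∀ t : ℝ, t • EuclideanSpace.single (0 : Fin 3) (1 : ℝ) = EuclideanSpace.single (0 : Fin 3) t :=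
    fun t => by ext i; simp
  have h : Continuous fun t : ℝ =>
      ((![0, t • EuclideanSpace.single (0 : Fin 3) (1 : ℝ)] : Fin 2 → EuclideanSpace ℝ (Fin 3))) :=
    continuous_const.matrixVecCons ((continuous_id.smul continuous_const).matrixVecCons continuous_const)
  simp only [hs] at h
  exact h

/-- Two axis pairs `(0, a e₀)`, `(0, b e₀)` with `|a − b| < r` are `r`-close. [folklore] -/
theorem dist_axisPair_lt {a b r : ℝ} (hr : 0 < r) (h : |a - b| < r) :
    dist ((![0, EuclideanSpace.single (0 : Fin 3) a] : Fin 2 → EuclideanSpace ℝ (Fin 3)))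
      (![0, EuclideanSpace.single (0 : Fin 3) b]) < r := by
  rw [dist_pi_lt_iff hr]
  intro i; fin_cases i
  · simpa using hr
  · simp [Real.dist_eq, h]

/-- Below the first lattice step the second point is discretised to the origin: `F_δ(2; 0, (δ/2) e₀) = g(⌊δ⁻¹⌋e₀)⁻¹`
(`= F_δ(2; 0, 0)`). [folklore] -/
theorem rescaled_pair_halfMesh {δ : ℝ} (hδ : 0 < δ) :
    rescaledCorrelator (criticalCorr 3) (fun δ : ℝ => (criticalTwoPoint 3 (Pi.single 0 ⌊δ⁻¹⌋)) ^ (-(1/2:ℝ))) 2 δ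
        ![0, EuclideanSpace.single (0 : Fin 3) (δ / 2)] = (criticalTwoPoint 3 (Pi.single 0 ⌊δ⁻¹⌋))⁻¹ := by
  rw [rescaled_pair_unitVec]
  have h : ⌊δ / 2 / δ⌋ = 0 := by
    rw [Int.floor_eq_zero_iff, div_right_comm, div_self hδ.ne', one_div]
    constructor <;> norm_num
  rw [h, Pi.single_zero, criticalTwoPoint_zero', mul_one]

/-- **Small meshes relative to `t`**: for `t > 0` and every `δ₀ > 0` there is a mesh `δ ∈ (0, δ₀)`, `δ ≤ t`, at which
`g(⌊t/δ⌋ e₀) < 1/2` (infrared upper bound `g(k e₀) ≤ C/k`). [folklore] -/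
theorem exists_mesh_twoPoint_lt_half {t : ℝ} (ht : 0 < t) (δ₀ : ℝ) (hδ₀ : 0 < δ₀) :
    ∃ δ ∈ Set.Ioo 0 δ₀, δ ≤ t ∧ criticalTwoPoint 3 (Pi.single (0 : Fin 3) ⌊t / δ⌋) < 1 / 2 := by
  obtain ⟨δ', hδ', hδ'1, hlt⟩ := exists_mesh_inv_twoPoint_gt 2 (δ₀ / t) (div_pos hδ₀ ht)
  refine ⟨δ' * t, ⟨mul_pos hδ'.1 ht, ?_⟩, ?_, ?_⟩
  · calc δ' * t < δ₀ / t * t := mul_lt_mul_of_pos_right hδ'.2 ht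
      _ = δ₀ := div_mul_cancel₀ δ₀ ht.ne'
  · calc δ' * t ≤ 1 * t := mul_le_mul_of_nonneg_right hδ'1 ht.le
      _ = t := one_mul t
  · have h1 : t / (δ' * t) = δ'⁻¹ := by rw [← div_div, div_right_comm, div_self ht.ne', one_div]
    rw [h1]
    have hg : 0 < criticalTwoPoint 3 (Pi.single 0 ⌊δ'⁻¹⌋) := criticalTwoPoint_pos3 _
    rw [one_div]
    exact (lt_inv_comm₀ two_pos hg).1 hlt

/-- The gap `F_δ(2; 0, 0-ish) − F_δ(2; 0, t e₀) ≥ 1/2` at the meshes of `exists_mesh_twoPoint_lt_half`: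
`g(⌊δ⁻¹⌋e₀)⁻¹ (1 − g(⌊t/δ⌋e₀)) ≥ 1/2` as soon as `g(⌊t/δ⌋e₀) < 1/2` (`g ≤ 1`). [folklore] -/
theorem half_le_gap {δ t : ℝ} (hlt : criticalTwoPoint 3 (Pi.single (0 : Fin 3) ⌊t / δ⌋) < 1 / 2) :
    1 / 2 ≤ |(criticalTwoPoint 3 (Pi.single 0 ⌊δ⁻¹⌋))⁻¹ -
        (criticalTwoPoint 3 (Pi.single 0 ⌊δ⁻¹⌋))⁻¹ * criticalTwoPoint 3 (Pi.single (0 : Fin 3) ⌊t / δ⌋)| := by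
  have hg : 0 < criticalTwoPoint 3 (Pi.single 0 ⌊δ⁻¹⌋) := criticalTwoPoint_pos3 _
  have hg1 : criticalTwoPoint 3 (Pi.single 0 ⌊δ⁻¹⌋) ≤ 1 := criticalTwoPoint_le_one' _
  have hA : 1 ≤ (criticalTwoPoint 3 (Pi.single 0 ⌊δ⁻¹⌋))⁻¹ := one_le_inv_iff₀.2 ⟨hg, hg1⟩
  have hB : 1 / 2 ≤ 1 - criticalTwoPoint 3 (Pi.single (0 : Fin 3) ⌊t / δ⌋) := by linarith
  have hBnn : 0 ≤ 1 - criticalTwoPoint 3 (Pi.single (0 : Fin 3) ⌊t / δ⌋) := by linarith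
  rw [← mul_one_sub, abs_of_nonneg (mul_nonneg (zero_le_one.trans hA) hBnn)]
  calc (1:ℝ) / 2 = 1 * (1 / 2) := (one_mul _).symm
    _ ≤ _ := mul_le_mul hA hB (by norm_num) (zero_le_one.trans hA)

/-! ### Clause (b): both hypotheses on `K` are load-bearing -/

/-- **`K ⊆ NonCoincident` is load-bearing for clause (b).** Clause (b) of the crux (asymptotic uniform
equicontinuity of the pinned rescaled correlators on `K`) with the non-coincidence hypothesis dropped is FALSE:
on the compact segment `K = {(0, t e₀) : t ∈ [0,1]}` the values at `(0,0)` and at `(0, t e₀)`, `t > 0` arbitrarily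
small, differ by `(1 − g(⌊t/δ⌋e₀))/g(⌊δ⁻¹⌋e₀) ≥ 1/2` for suitable `δ < δ₀`. [folklore] -/
theorem clauseB_false_without_nonCoincident :
    ¬ (∀ (n : ℕ) (K : Set (Fin n → EuclideanSpace ℝ (Fin 3))), IsCompact K →
        ∀ ε : ℝ, 0 < ε → ∃ r δ₀ : ℝ, 0 < r ∧ 0 < δ₀ ∧ ∀ δ ∈ Set.Ioo 0 δ₀, ∀ x ∈ K, ∀ y ∈ K, dist x y < r →
          |rescaledCorrelator (criticalCorr 3)
              (fun δ : ℝ => (criticalTwoPoint 3 (Pi.single 0 ⌊δ⁻¹⌋)) ^ (-(1/2:ℝ))) n δ x -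
            rescaledCorrelator (criticalCorr 3)
              (fun δ : ℝ => (criticalTwoPoint 3 (Pi.single 0 ⌊δ⁻¹⌋)) ^ (-(1/2:ℝ))) n δ y| < ε) := by
  intro h
  set K : Set (Fin 2 → EuclideanSpace ℝ (Fin 3)) :=
    (fun t : ℝ => ((![0, EuclideanSpace.single (0 : Fin 3) t] : Fin 2 → EuclideanSpace ℝ (Fin 3)))) ''
      Set.Icc (0:ℝ) 1 with hK
  have hKc : IsCompact K := isCompact_Icc.image continuous_axisPair
  obtain ⟨r, δ₀, hr, hδ₀, hb⟩ := h 2 K hKc (1 / 2) (by norm_num)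
  -- the second point at parameter `t = min (r/2) 1 > 0`, the first at the origin (`t = 0`)
  set t : ℝ := min (r / 2) 1 with ht
  have htpos : 0 < t := lt_min (by positivity) one_pos
  have ht1 : t ≤ 1 := min_le_right _ _
  have htr : t < r := (min_le_left _ _).trans_lt (by linarith)
  obtain ⟨δ, hδ, -, hlt⟩ := exists_mesh_twoPoint_lt_half htpos δ₀ hδ₀
  have hx : ((![0, EuclideanSpace.single (0 : Fin 3) (0:ℝ)] : Fin 2 → EuclideanSpace ℝ (Fin 3))) ∈ K :=
    ⟨0, ⟨le_rfl, zero_le_one⟩, rfl⟩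
  have hy : ((![0, EuclideanSpace.single (0 : Fin 3) t] : Fin 2 → EuclideanSpace ℝ (Fin 3))) ∈ K :=
    ⟨t, ⟨htpos.le, ht1⟩, rfl⟩
  have hd := hb δ hδ _ hx _ hy (dist_axisPair_lt hr (by rw [zero_sub, abs_neg, abs_of_pos htpos]; exact htr))
  rw [rescaled_pair_unitVec, rescaled_pair_unitVec, zero_div, Int.floor_zero, Pi.single_zero,
    criticalTwoPoint_zero', mul_one] at hd
  linarith [half_le_gap hlt]

/-- **`IsCompact K` is load-bearing for clause (b).** Clause (b) with compactness dropped is FALSE: on the bounded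
non-closed `K = {(0, t e₀) : t ∈ (0,1]} ⊆ NonCoincident 3 2` the `t`-close pair `(0, (δ/2) e₀)`, `(0, t e₀)` has
`F_δ`-values differing by `(1 − g(⌊t/δ⌋e₀))/g(⌊δ⁻¹⌋e₀) ≥ 1/2` for suitable `δ < δ₀`, `δ ≤ t`. [folklore] -/
theorem clauseB_false_without_compact :
    ¬ (∀ (n : ℕ) (K : Set (Fin n → EuclideanSpace ℝ (Fin 3))), K ⊆ NonCoincident 3 n →
        ∀ ε : ℝ, 0 < ε → ∃ r δ₀ : ℝ, 0 < r ∧ 0 < δ₀ ∧ ∀ δ ∈ Set.Ioo 0 δ₀, ∀ x ∈ K, ∀ y ∈ K, dist x y < r →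
          |rescaledCorrelator (criticalCorr 3)
              (fun δ : ℝ => (criticalTwoPoint 3 (Pi.single 0 ⌊δ⁻¹⌋)) ^ (-(1/2:ℝ))) n δ x -
            rescaledCorrelator (criticalCorr 3)
              (fun δ : ℝ => (criticalTwoPoint 3 (Pi.single 0 ⌊δ⁻¹⌋)) ^ (-(1/2:ℝ))) n δ y| < ε) := by
  intro h
  set K : Set (Fin 2 → EuclideanSpace ℝ (Fin 3)) :=
    {x | ∃ t ∈ Set.Ioc (0:ℝ) 1, x = ![0, EuclideanSpace.single (0 : Fin 3) t]} with hK
  have hKnc : K ⊆ NonCoincident 3 2 := by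
    rintro x ⟨t, ht, rfl⟩
    exact zero_unitVec_mem_nonCoincident ht.1.ne'
  obtain ⟨r, δ₀, hr, hδ₀, hb⟩ := h 2 K hKnc (1 / 2) (by norm_num)
  set t : ℝ := min (r / 2) 1 with ht
  have htpos : 0 < t := lt_min (by positivity) one_pos
  have ht1 : t ≤ 1 := min_le_right _ _
  have htr : t < r := (min_le_left _ _).trans_lt (by linarith)
  obtain ⟨δ, hδ, hδt, hlt⟩ := exists_mesh_twoPoint_lt_half htpos δ₀ hδ₀
  have hx : ((![0, EuclideanSpace.single (0 : Fin 3) (δ / 2)] : Fin 2 → EuclideanSpace ℝ (Fin 3))) ∈ K :=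
    ⟨δ / 2, ⟨by linarith [hδ.1], by linarith⟩, rfl⟩
  have hy : ((![0, EuclideanSpace.single (0 : Fin 3) t] : Fin 2 → EuclideanSpace ℝ (Fin 3))) ∈ K :=
    ⟨t, ⟨htpos, ht1⟩, rfl⟩
  have hdist : |δ / 2 - t| < r := by
    rw [abs_sub_comm, abs_of_pos (by linarith [hδ.1])]
    linarith [hδ.1]
  have hd := hb δ hδ _ hx _ hy (dist_axisPair_lt hr hdist)
  rw [rescaled_pair_halfMesh hδ.1, rescaled_pair_unitVec] at hd
  linarith [half_le_gap hlt]

/-! ### Clause (b): `δ₀` must depend on `ε` (fixed-mesh step functions jump) -/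

/-- `g(k e₀) → 0` along the axis (infrared upper bound `g(k e₀) ≤ C/k`). [folklore] -/
theorem criticalTwoPoint_axis_tendsto_zero :
    Tendsto (fun k : ℕ => criticalTwoPoint 3 (Pi.single (0 : Fin 3) (k : ℤ))) atTop (𝓝 0) := by
  obtain ⟨c, C, hc, hb⟩ := criticalTwoPoint_bounds_holds (d := 3) le_rfl
  have hup : ∀ k : ℕ, 1 ≤ k → criticalTwoPoint 3 (Pi.single (0 : Fin 3) (k : ℤ)) ≤ C / (k : ℝ) := by
    intro k hk
    have hkpos : (0:ℝ) < k := by exact_mod_cast hk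
    have hx : (Pi.single (0 : Fin 3) (k : ℤ) : Site 3) ≠ 0 := by
      intro h0
      have := congrFun h0 0
      rw [Pi.single_eq_same] at this
      have : (k : ℤ) = 0 := this
      omega
    have h2 := (hb _ hx).2
    rw [norm_single_axis, Int.cast_natCast, abs_of_pos hkpos,
      show (-(((3:ℕ):ℝ) - 2)) = -1 by norm_num, Real.rpow_neg_one] at h2
    rwa [div_eq_mul_inv]
  refine tendsto_of_tendsto_of_tendsto_of_le_of_le' tendsto_const_nhds
    (tendsto_const_div_atTop_nhds_zero_nat C) ?_ ?_
  · exact Eventually.of_forall fun k => (criticalTwoPoint_pos3 _).le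
  · filter_upwards [eventually_ge_atTop 1] with k hk using hup k hk

/-- Beyond every `k₀` the axis two-point function has a STRICT one-step decrease `g((k+1)e₀) < g(k e₀)`
(`g > 0`, `g(k e₀) → 0`). [folklore] -/
theorem exists_axis_strictStep (k₀ : ℕ) :
    ∃ k : ℕ, k₀ ≤ k ∧ criticalTwoPoint 3 (Pi.single (0 : Fin 3) ((k + 1 : ℕ) : ℤ)) <
      criticalTwoPoint 3 (Pi.single (0 : Fin 3) (k : ℤ)) := by
  by_contra hcon
  push Not at hcon
  -- then `g` is nondecreasing from `k₀` on, so `g(k e₀) ≥ g(k₀ e₀) > 0` for all `k ≥ k₀`, against `g → 0`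
  have hmono : ∀ k : ℕ, k₀ ≤ k → criticalTwoPoint 3 (Pi.single (0 : Fin 3) (k₀ : ℤ)) ≤
      criticalTwoPoint 3 (Pi.single (0 : Fin 3) (k : ℤ)) := by
    intro k hk
    induction k, hk using Nat.le_induction with
    | base => exact le_rfl
    | succ m hm ih => exact ih.trans (hcon m hm)
  have hpos : 0 < criticalTwoPoint 3 (Pi.single (0 : Fin 3) (k₀ : ℤ)) := criticalTwoPoint_pos3 _
  have hev : ∀ᶠ k : ℕ in atTop, criticalTwoPoint 3 (Pi.single (0 : Fin 3) (k₀ : ℤ)) ≤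
      criticalTwoPoint 3 (Pi.single (0 : Fin 3) (k : ℤ)) := by
    filter_upwards [eventually_ge_atTop k₀] with k hk using hmono k hk
  have := ge_of_tendsto criticalTwoPoint_axis_tendsto_zero hev
  linarith

/-- **`δ₀ = δ₀(ε)` is load-bearing in clause (b).** The strengthening of clause (b) in which the mesh threshold `δ₀`
is chosen BEFORE `ε` (equicontinuity of the whole family `{F_δ(n;·) : 0 < δ < δ₀}` on `K`) is FALSE, already on the
compact `K = {(0, t e₀) : t ∈ [1,3]} ⊆ NonCoincident 3 2`: given `δ₀`, pick a strict step `g((k+1)e₀) < g(k e₀)` with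
`2/(k+1) < δ₀`, the mesh `δ = 2/(k+1)` and `ε =` the jump `(g(k e₀) − g((k+1)e₀))/g(⌊δ⁻¹⌋e₀)`; the points
`(0, (2−τ)e₀)`, `(0, 2e₀)` (`τ` small) are discretised to `k e₀`, `(k+1) e₀` and realise the jump exactly. [folklore] -/
theorem clauseB_false_with_meshUniform_delta0 :
    ¬ (∀ (n : ℕ) (K : Set (Fin n → EuclideanSpace ℝ (Fin 3))), K ⊆ NonCoincident 3 n → IsCompact K →
        ∃ δ₀ : ℝ, 0 < δ₀ ∧ ∀ ε : ℝ, 0 < ε → ∃ r : ℝ, 0 < r ∧ ∀ δ ∈ Set.Ioo 0 δ₀, ∀ x ∈ K, ∀ y ∈ K,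
          dist x y < r →
          |rescaledCorrelator (criticalCorr 3)
              (fun δ : ℝ => (criticalTwoPoint 3 (Pi.single 0 ⌊δ⁻¹⌋)) ^ (-(1/2:ℝ))) n δ x -
            rescaledCorrelator (criticalCorr 3)
              (fun δ : ℝ => (criticalTwoPoint 3 (Pi.single 0 ⌊δ⁻¹⌋)) ^ (-(1/2:ℝ))) n δ y| < ε) := by
  intro h
  set K : Set (Fin 2 → EuclideanSpace ℝ (Fin 3)) :=
    (fun t : ℝ => ((![0, EuclideanSpace.single (0 : Fin 3) t] : Fin 2 → EuclideanSpace ℝ (Fin 3)))) ''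
      Set.Icc (1:ℝ) 3 with hK
  have hKnc : K ⊆ NonCoincident 3 2 := by
    rintro x ⟨t, ht, rfl⟩
    exact zero_unitVec_mem_nonCoincident (one_pos.trans_le ht.1).ne'
  have hKc : IsCompact K := isCompact_Icc.image continuous_axisPair
  obtain ⟨δ₀, hδ₀, hb⟩ := h 2 K hKnc hKc
  -- a strict step beyond `2/δ₀`
  obtain ⟨k₀, hk₀⟩ := exists_nat_gt (2 / δ₀)
  obtain ⟨k, hk, hstep⟩ := exists_axis_strictStep k₀
  have hk1pos : (0:ℝ) < (k:ℝ) + 1 := by positivity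
  have hkδ : 2 / δ₀ < (k:ℝ) + 1 := by
    have : (k₀:ℝ) ≤ k := by exact_mod_cast hk
    linarith
  -- the mesh `δ = 2/(k+1) ∈ (0, δ₀)`
  set δ : ℝ := 2 / ((k:ℝ) + 1) with hδdef
  have hδpos : 0 < δ := by positivity
  have hδlt : δ < δ₀ := by
    rw [hδdef, div_lt_iff₀ hk1pos]
    have := (div_lt_iff₀ hδ₀).1 hkδ
    linarith
  have hA : 0 < (criticalTwoPoint 3 (Pi.single 0 ⌊δ⁻¹⌋))⁻¹ := inv_pos.2 (criticalTwoPoint_pos3 _)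
  -- `ε` = the jump
  set ε : ℝ := (criticalTwoPoint 3 (Pi.single 0 ⌊δ⁻¹⌋))⁻¹ *
      (criticalTwoPoint 3 (Pi.single (0 : Fin 3) (k : ℤ)) -
        criticalTwoPoint 3 (Pi.single (0 : Fin 3) ((k + 1 : ℕ) : ℤ))) with hεdef
  have hε : 0 < ε := mul_pos hA (by linarith)
  obtain ⟨r, hr, hb'⟩ := hb ε hε
  -- the two points: parameters `2 - τ` and `2`, `τ = min r δ / 2`
  set τ : ℝ := min r δ / 2 with hτ
  have hτpos : 0 < τ := by positivity
  have hτr : τ < r := by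
    have : min r δ ≤ r := min_le_left _ _
    rw [hτ]; linarith
  have hτδ : τ < δ := by
    have : min r δ ≤ δ := min_le_right _ _
    rw [hτ]; linarith
  have hδle1 : δ ≤ 1 := by
    rw [hδdef, div_le_one hk1pos]
    have : (2 / δ₀ : ℝ) > 0 := by positivity
    have hk1 : (1:ℝ) ≤ k := by
      have : (k₀ : ℝ) ≤ k := by exact_mod_cast hk
      by_contra hlt
      push Not at hlt
      have hk0 : (k:ℝ) = 0 := by
        have : k < 1 := by exact_mod_cast hlt
        have : k = 0 := by omega
        simp [this]
      linarith
    linarith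
  have hx : ((![0, EuclideanSpace.single (0 : Fin 3) (2 - τ)] : Fin 2 → EuclideanSpace ℝ (Fin 3))) ∈ K :=
    ⟨2 - τ, ⟨by linarith, by linarith⟩, rfl⟩
  have hy : ((![0, EuclideanSpace.single (0 : Fin 3) (2:ℝ)] : Fin 2 → EuclideanSpace ℝ (Fin 3))) ∈ K :=
    ⟨2, ⟨by norm_num, by norm_num⟩, rfl⟩
  have hdist : |2 - τ - 2| < r := by
    rw [show (2:ℝ) - τ - 2 = -τ by ring, abs_neg, abs_of_pos hτpos]; exact hτr
  have hd := hb' δ ⟨hδpos, hδlt⟩ _ hx _ hy (dist_axisPair_lt hr hdist)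
  -- discretisations: `⌊2/δ⌋ = k+1`, `⌊(2-τ)/δ⌋ = k`
  have h2δ : (2:ℝ) / δ = (k:ℝ) + 1 := by
    rw [hδdef, div_div_eq_mul_div, mul_comm, mul_div_assoc, div_self (two_ne_zero), mul_one]
  have hfl2 : ⌊(2:ℝ) / δ⌋ = ((k + 1 : ℕ) : ℤ) := by
    rw [h2δ, Int.floor_eq_iff]; push_cast; constructor <;> linarith
  have hfl1 : ⌊(2 - τ) / δ⌋ = (k : ℤ) := by
    rw [Int.floor_eq_iff, sub_div, h2δ]
    have h1 : τ / δ < 1 := (div_lt_one hδpos).2 hτδ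
    have h2 : 0 < τ / δ := div_pos hτpos hδpos
    push_cast
    constructor <;> linarith
  rw [rescaled_pair_unitVec, rescaled_pair_unitVec, hfl1, hfl2, ← mul_sub] at hd
  -- `hd : |ε| < ε`
  rw [abs_of_pos hε] at hd
  exact lt_irrefl _ hd

/-! ### Clause (c): the order `n = 2` is load-bearing (odd orders vanish identically) -/

/-- The configuration `(0, e₀, 2e₀, …, (n-1)e₀)` is non-coincident. [folklore] -/
theorem axisConfig_mem_nonCoincident (n : ℕ) :
    (fun i : Fin n => EuclideanSpace.single (0 : Fin 3) ((i : ℕ) : ℝ)) ∈ NonCoincident 3 n := by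
  rw [mem_nonCoincident]
  intro i j hij
  have h := congrArg (fun v : EuclideanSpace ℝ (Fin 3) => v 0) hij
  simp only [PiLp.single_apply, if_true] at h
  exact Fin.ext (by exact_mod_cast h)

/-- **Clause (c) is false at every odd order.** The positive lower bound of clause (c), stated for an odd `n`
instead of `n = 2`, fails: `F_δ(n; ·) ≡ 0` for odd `n` since `m*(β_c) = 0` (`criticalCorr_eq_zero_of_odd`); witness
the compact singleton `{(0, e₀, …, (n-1)e₀)} ⊆ NonCoincident 3 n`. [folklore] -/
theorem clauseC_false_at_odd {n : ℕ} (hn : Odd n) :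
    ¬ (∀ K : Set (Fin n → EuclideanSpace ℝ (Fin 3)), K ⊆ NonCoincident 3 n → IsCompact K →
        ∃ m δ₀ : ℝ, 0 < m ∧ 0 < δ₀ ∧ ∀ δ ∈ Set.Ioo 0 δ₀, ∀ x ∈ K,
          m ≤ rescaledCorrelator (criticalCorr 3)
            (fun δ : ℝ => (criticalTwoPoint 3 (Pi.single 0 ⌊δ⁻¹⌋)) ^ (-(1/2:ℝ))) n δ x) := by
  intro h
  set x₀ : Fin n → EuclideanSpace ℝ (Fin 3) := fun i => EuclideanSpace.single (0 : Fin 3) ((i : ℕ) : ℝ) with hx₀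
  obtain ⟨m, δ₀, hm, hδ₀, hb⟩ := h {x₀} (by
    intro x hx; rw [Set.mem_singleton_iff] at hx; subst hx; exact axisConfig_mem_nonCoincident n)
    isCompact_singleton
  have hδ : δ₀ / 2 ∈ Set.Ioo 0 δ₀ := ⟨by positivity, by linarith⟩
  have hv := hb (δ₀ / 2) hδ x₀ (Set.mem_singleton _)
  rw [rescaledCorrelator_apply, criticalCorr_eq_zero_of_odd le_rfl hn, mul_zero] at hv
  linarith

/-- The instance `n = 1` of `clauseC_false_at_odd` (the one-point function vanishes at `β_c`). [folklore] -/
theorem clauseC_false_at_one :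
    ¬ (∀ K : Set (Fin 1 → EuclideanSpace ℝ (Fin 3)), K ⊆ NonCoincident 3 1 → IsCompact K →
        ∃ m δ₀ : ℝ, 0 < m ∧ 0 < δ₀ ∧ ∀ δ ∈ Set.Ioo 0 δ₀, ∀ x ∈ K,
          m ≤ rescaledCorrelator (criticalCorr 3)
            (fun δ : ℝ => (criticalTwoPoint 3 (Pi.single 0 ⌊δ⁻¹⌋)) ^ (-(1/2:ℝ))) 1 δ x) :=
  clauseC_false_at_odd odd_one

end Summit.CriticalPhenomena.Ising3DConformalLimit.UniformRegularityNegative
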